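import Summits.QuantumFields.YangMills.Theorems.SwapVirialDeficitSectorLaplaceBTubeFibredRegion
import Summits.QuantumFields.YangMills.Theorems.SwapVirialDeficitQuantitativeLaplaceFibred
import HarnessLib

/-!
# STUB (S-B) OF SKELETON ➎: THE B-TUBE MAIN TERM — law, determinant window and integrable, positive main density carried by ONE operator family
# (free-hands support of ⟨stmt-QuantumFields-24197⟩ `SwapVirialDeficit.SwapGluedStiffness` ∕ ⟨24194⟩; cell ym-idea-1, LEAD memo7 §E(3); input of the log-law ∕ action step)

✓`bTube_fibred_region_uniform` hides its operators behind an `∃` with four properties; the log-law step (✓`twoSided_logLaw_of_relative` ∕ ✓`setStiffness_of_twoSided_logLaplace`,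
g47's bulk pattern) needs MORE about the same operators: an UPPER form bound (for `det ≤`, hence a main-term FLOOR) and the INTEGRABILITY of `u ↦ w₀(u)∕√det A′_u`.  This file:
* §1 `det_le_pow_of_inner_le` (symmetric, coercive, `⟪Ay,y⟫ ≤ C‖y‖²` ⟹ `det A ≤ C^m`); ★ `bTube_law_of_socketData` — the law for EXPLICIT socket data;
* §2 ★★★ `bTube_mainTerm_package (ε) (hz) (hε) (hτ) (hτ1)` — ONE operator family `A′` with: symmetric; measurable form; ray identity; `λ_B‖y‖² ≤ ⟪A′_u y,y⟫` on `{τ² ≤ |u|²}`;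
  `⟪A′_u y,y⟫ ≤ 39984L⁴‖y‖²` for ALL `u` (K7e, ✓`bFibre_rescaled_lineJets`); `λ_B^{m_B} ≤ det A′_u ≤ (39984L⁴)^{m_B}` on `{τ² ≤ |u|²}`;
  `IntegrableOn (u ↦ w₀(u)∕√det A′_u) {τ² ≤ |u|²}` (Fubini, ✓`integral_gaussian_fibred` on the base-projected family); and the law of ✓`bTube_fibred_region_uniform` for this `A′`.

HONEST LABEL: (S-B) is NOT closed (far floor on BTubeCap; the log-law ∕ action step; the BTubeCap reading); (S-core), (S-001), ⟨24197⟩ ∕ ⟨24194⟩ OPEN; own crux ⟨22884⟩ OPEN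
(blocked-on ⟨19935⟩); the Yang–Mills mass gap is NOT proved; no summit is proved by a line.  THEOREMS ONLY (0 `def`, 0 `sorry`), standard axioms.  Width seat ym-line-sfw-p2-w2 g59
(cell ym-idea-1, free hands), `--supports stmt-QuantumFields-24197`.  References: [cite: Luscher1983, §2]; [cite: HasenpflugRudolfSprungk2024, App. 4.1 Thm 16];
[cite: Breitung1994, Lemma 26 (2.102), p. 30]; [folklore].
-/



set_option autoImplicit false
set_option synthInstance.maxSize 1024

noncomputable section

open MeasureTheory Quaternion Set Metric Module
open scoped Quaternion BigOperators ENNReal InnerProductSpace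
open Literature.MathematicalPhysics.QuantumLattice
open Literature.MathematicalPhysics.QuantumFieldTheory hiding SU2

namespace Summit.QuantumFields.YangMills.Theorems.SwapVirialDeficit.BlowUpRing

open Summit.QuantumFields.YangMills.Theorems.FemtoTransferGap
open Summit.QuantumFields.YangMills.Theorems.FemtoTransferGap.TT
open Summit.QuantumFields.YangMills.Theorems.VirialFluxGap.RingDeficit
open Summit.QuantumFields.YangMills.Theorems.SwapVirialDeficit.SwapRing
open Summit.QuantumFields.YangMills.Theorems.SwapVirialDeficit.Gnomonic (normSq3 normSq3_nonneg gnomonicWeight gnomonicWeight_pos)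
open Summit.QuantumFields.YangMills.Theorems.QuantitativeLaplace (laplaceMethod_quantitative_fibred_chart_cubic_offBound_on offTube_bound_of_cylinder
  det_le_det_of_inner_le integral_gaussian_fibred baseProj_mem measurable_baseProj)

variable {L : ℕ} [NeZero L]

/-! ## §1 A determinant ceiling and the law for explicit socket data -/

omit [NeZero L] in
/-- `det A ≤ C^m` for a symmetric `λ`-coercive operator with `⟪Ay,y⟫ ≤ C‖y‖²` (✓`det_le_det_of_inner_le` against `C·id`). [cite: Breitung1994, Lemma 26 (2.102), p. 30] -/
theorem det_le_pow_of_inner_le {V : Type*} [NormedAddCommGroup V] [InnerProductSpace ℝ V] [FiniteDimensional ℝ V] [MeasurableSpace V] [BorelSpace V]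
    {A : V →ₗ[ℝ] V} (hA : A.IsSymmetric) {lam C : ℝ} (hlam : 0 < lam) (hcoer : ∀ y : V, lam * ‖y‖ ^ 2 ≤ ⟪A y, y⟫_ℝ) (hup : ∀ y : V, ⟪A y, y⟫_ℝ ≤ C * ‖y‖ ^ 2) :
    LinearMap.det A ≤ C ^ finrank ℝ V := by
  have hI : (C • (LinearMap.id : V →ₗ[ℝ] V)).IsSymmetric := fun x y => by
    simp only [LinearMap.smul_apply, LinearMap.id_coe, id_eq, real_inner_smul_left, real_inner_smul_right]
  have hIq : ∀ y : V, ⟪(C • (LinearMap.id : V →ₗ[ℝ] V)) y, y⟫_ℝ = C * ‖y‖ ^ 2 := fun y => by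
    simp only [LinearMap.smul_apply, LinearMap.id_coe, id_eq, real_inner_smul_left, real_inner_self_eq_norm_sq]
  have h := det_le_det_of_inner_le hA hI hlam hcoer (fun y => by rw [hIq]; exact hup y)
  rwa [LinearMap.det_smul, LinearMap.det_id, mul_one] at h

/-- ★★ **THE B-TUBE √b LAW FROM EXPLICIT SOCKET DATA** (principal signs, `0 < τ`): the conclusion of ✓`bTube_fibred_region_uniform` for a GIVEN operator family `A` with the
socket properties of ✓`bFibre_rescaled_sockets` (symmetric, measurable form, ray identity, `λ_B`-coercive on `{τ² ≤ |u|²}`, cubic identity with datum `ρ`, amplitude `w₀(u)(1+e)`,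
`|e| ≤ 2R‖y‖`) — so that the SAME `A` carries the law, the determinant bounds and the main-term facts below. [cite: Luscher1983, §2] [cite: HasenpflugRudolfSprungk2024, App. 4.1 Thm 16] -/
theorem bTube_law_of_socketData (ε : GnoSign L) (hz : ε.2.1 = true) (hε : ε.2.2 = fun _ => true) {τ : ℝ} (hτ : 0 < τ)
    {A : ℝ × ℝ → GnoFibreB L →ₗ[ℝ] GnoFibreB L} {ρ e : (ℝ × ℝ) × GnoFibreB L → ℝ} (hAs : ∀ u, (A u).IsSymmetric)
    (hAm : Measurable fun q : (ℝ × ℝ) × GnoFibreB L => ⟪A q.1 q.2, q.2⟫_ℝ) (hρm : Measurable ρ) (hem : Measurable e)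
    (hray : ∀ u (y : GnoFibreB L), ⟪A u y, y⟫_ℝ =
      iteratedDeriv 2 (fun s : ℝ => gnoDeficit (fun _ => false) (fun _ => 1) (hubAt (gnoBaseB u + s • gnoFibreBEmb (gnoScaleB u y)).1 1) ε
        (gnoBaseB u + s • gnoFibreBEmb (gnoScaleB u y)).2) 0)
    (hcoer : ∀ u : ℝ × ℝ, τ ^ 2 ≤ u.1 ^ 2 + u.2 ^ 2 → ∀ y : GnoFibreB L, τ ^ 2 / ((1 + τ ^ 2) * (12375 * (L : ℝ) ^ 10)) * ‖y‖ ^ 2 ≤ ⟪A u y, y⟫_ℝ)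
    (hf : ∀ u (y : GnoFibreB L), gnoDeficit (fun _ => false) (fun _ => 1) (hubAt (gnoFibreBEquiv (u, gnoScaleB u y)).1 1) ε (gnoFibreBEquiv (u, gnoScaleB u y)).2 - 0 =
      (1 / 2) * ⟪A u y, y⟫_ℝ + ρ (u, y))
    (hw : ∀ u (y : GnoFibreB L), (∏ i, |gnoFibreBScale (L := L) u i|) *
        (((1 + (gnoFibreBEquiv (u, gnoScaleB u y)).1 ^ 2)⁻¹) ^ 2 * gnoDensity (gnoFibreBEquiv (u, gnoScaleB u y)).2) * 1 =
      gnomonicWeight (![0, u.1, u.2] : Fin 3 → ℝ) * Real.sqrt (1 + (u.1 ^ 2 + u.2 ^ 2)) * (1 + e (u, y)))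
    (heb : ∀ R : ℝ, 0 ≤ R → ∀ u (y : GnoFibreB L), ‖y‖ ≤ R → |e (u, y)| ≤ (2 * R) * ‖y‖) :
      ∀ {S : Set (ℝ × ℝ)}, MeasurableSet S → S ⊆ {u : ℝ × ℝ | τ ^ 2 ≤ u.1 ^ 2 + u.2 ^ 2} → ∀ {p₀ : ℝ × ℝ}, p₀ ∈ S →
      ∀ {Rg : Set (ℝ × GnoCoord L)}, MeasurableSet Rg → ∀ {R b : ℝ}, 0 < R → 0 < b →
        (∀ u ∈ S, ∀ y : GnoFibreB L, ‖y‖ ≤ R → gnoFibreBEquiv (u, gnoScaleB u y) ∈ Rg) → Rg ⊆ {p : ℝ × GnoCoord L | (p.2.1.1 1, p.2.1.1 2) ∈ S} →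
        1136016 * (L : ℝ) ^ 4 * R ≤ τ ^ 2 / ((1 + τ ^ 2) * (12375 * (L : ℝ) ^ 10)) / (8 * ((finrank ℝ (GnoFibreB L) : ℝ) + 8)) → 2 * R * R ≤ 1 →
        (∀ u ∈ S, ∀ y : GnoFibreB L, R ≤ ‖y‖ → gnoFibreBEquiv (u, gnoScaleB u y) ∈ Rg →
          τ ^ 2 / ((1 + τ ^ 2) * (12375 * (L : ℝ) ^ 10)) * R ^ 2 ≤
            gnoDeficit (fun _ => false) (fun _ => 1) (hubAt (gnoFibreBEquiv (u, gnoScaleB u y)).1 1) ε (gnoFibreBEquiv (u, gnoScaleB u y)).2) →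
        |(∫ p in Rg,
              Real.exp (-(b * gnoDeficit (fun _ => false) (fun _ => 1) (hubAt p.1 1) ε p.2))
              ∂((volume : Measure (ℝ × GnoCoord L)).withDensity fun p => ENNReal.ofReal (((1 + p.1 ^ 2)⁻¹) ^ 2 * gnoDensity p.2))) -
            (2 * Real.pi / b) ^ ((finrank ℝ (GnoFibreB L) : ℝ) / 2) *
              ∫ u in S, gnomonicWeight (![0, u.1, u.2] : Fin 3 → ℝ) * Real.sqrt (1 + (u.1 ^ 2 + u.2 ^ 2)) / Real.sqrt (LinearMap.det (A u))| ≤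
          ((16 * (1136016 * (L : ℝ) ^ 4) * ((finrank ℝ (GnoFibreB L) : ℝ) + 8) / (τ ^ 2 / ((1 + τ ^ 2) * (12375 * (L : ℝ) ^ 10))) +
                  256 * (1136016 * (L : ℝ) ^ 4) * ((finrank ℝ (GnoFibreB L) : ℝ) + 8) ^ 2 / (τ ^ 2 / ((1 + τ ^ 2) * (12375 * (L : ℝ) ^ 10))) ^ 2 + 2 * R +
                  8 * (2 * R) * ((finrank ℝ (GnoFibreB L) : ℝ) + 8) / (τ ^ 2 / ((1 + τ ^ 2) * (12375 * (L : ℝ) ^ 10)))) / Real.sqrt b +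
              16 * ((finrank ℝ (GnoFibreB L) : ℝ) + 8) / (τ ^ 2 / ((1 + τ ^ 2) * (12375 * (L : ℝ) ^ 10)) * R ^ 2) / b) *
            ((2 * Real.pi / b) ^ ((finrank ℝ (GnoFibreB L) : ℝ) / 2) *
              ∫ u in S, gnomonicWeight (![0, u.1, u.2] : Fin 3 → ℝ) * Real.sqrt (1 + (u.1 ^ 2 + u.2 ^ 2)) / Real.sqrt (LinearMap.det (A u))) +
          Real.exp (-(b * (τ ^ 2 / ((1 + τ ^ 2) * (12375 * (L : ℝ) ^ 10)) * R ^ 2))) *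
            ((volume : Measure (ℝ × GnoCoord L)).withDensity fun p => ENNReal.ofReal (((1 + p.1 ^ 2)⁻¹) ^ 2 * gnoDensity p.2)).real univ := by
  intro S hS hSτ p₀ hp₀ Rg hRgm R b hR hb htube hcyl hsmall hDR hfar
  have hL : (0 : ℝ) < (L : ℝ) := by exact_mod_cast NeZero.pos L
  set lam : ℝ := τ ^ 2 / ((1 + τ ^ 2) * (12375 * (L : ℝ) ^ 10)) with hlam
  have hlam0 : 0 < lam := by positivity
  have hA₃ : (0 : ℝ) ≤ 1136016 * (L : ℝ) ^ 4 := by positivity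
  -- the measure space and the letters
  set μB : Measure (ℝ × GnoCoord L) := (volume : Measure (ℝ × GnoCoord L)).withDensity fun p => ENNReal.ofReal (((1 + p.1 ^ 2)⁻¹) ^ 2 * gnoDensity p.2) with hμB
  haveI : IsFiniteMeasure μB := isFiniteMeasure_muB
  set f : ℝ × GnoCoord L → ℝ := fun p => gnoDeficit (fun _ => false) (fun _ => 1) (hubAt p.1 1) ε p.2 with hfdef
  have hfm : Measurable f := measurable_bDeficit _ _ ε
  set φ : ℝ × GnoCoord L → ℝ := Rg.indicator (fun _ => (1 : ℝ)) with hφ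
  have hφm : Measurable φ := measurable_const.indicator hRgm
  set Ψ' : (ℝ × ℝ) × GnoFibreB L → ℝ × GnoCoord L := fun q => gnoFibreBEquiv (q.1, gnoScaleB q.1 q.2) with hΨ'
  obtain ⟨hTm, hchart⟩ := volume_muB_restrict_scaledBTube_eq_map (L := L) hS R
  have hΨm : Measurable Ψ' := measurable_gnoScaleBChart (L := L)
  have hJm : Measurable fun q : (ℝ × ℝ) × GnoFibreB L =>
      (∏ i, |gnoFibreBScale (L := L) q.1 i|) * (((1 + (gnoFibreBEquiv (q.1, gnoScaleB q.1 q.2)).1 ^ 2)⁻¹) ^ 2 * gnoDensity (gnoFibreBEquiv (q.1, gnoScaleB q.1 q.2)).2) :=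
    (Finset.measurable_prod _ fun i _ => ((measurable_gnoFibreBScale i).comp measurable_fst).abs).mul (measurable_bDensity.comp (measurable_gnoScaleBChart (L := L)))
  have hJ0 : ∀ q ∈ S ×ˢ closedBall (0 : GnoFibreB L) R,
      0 ≤ (∏ i, |gnoFibreBScale (L := L) q.1 i|) * (((1 + (gnoFibreBEquiv (q.1, gnoScaleB q.1 q.2)).1 ^ 2)⁻¹) ^ 2 * gnoDensity (gnoFibreBEquiv (q.1, gnoScaleB q.1 q.2)).2) :=
    fun q _ => mul_nonneg (Finset.prod_nonneg fun i _ => abs_nonneg _) (bDensity_pos _).le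
  obtain ⟨hw0pos, hw0m, hw0i⟩ := bBaseWeight_facts
  -- coercivity and the cubic constant on `S`
  have hcoerS : ∀ u ∈ S, ∀ y : GnoFibreB L, lam * ‖y‖ ^ 2 ≤ ⟪A u y, y⟫_ℝ := fun u hu y => hcoer u (hSτ hu) y
  have hρS : ∀ u ∈ S, ∀ y : GnoFibreB L, ‖y‖ ≤ R → |ρ (u, y)| ≤ 1136016 * (L : ℝ) ^ 4 * ‖y‖ ^ 3 := by
    intro u _ y _
    have eρ : ρ (u, y) = gnoDeficit (fun _ => false) (fun _ => 1) (hubAt (gnoFibreBEquiv (u, gnoScaleB u y)).1 1) ε (gnoFibreBEquiv (u, gnoScaleB u y)).2 -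
        (1 / 2) * ⟪A u y, y⟫_ℝ := by linarith [hf u y]
    rw [eρ, hray]
    exact bFibre_rescaled_cubic ε hz hε u y
  -- membership of tube points in the region
  have hmemRg : ∀ u ∈ S, ∀ y : GnoFibreB L, ‖y‖ ≤ R → Ψ' (u, y) ∈ Rg := fun u hu y hy => htube u hu y hy
  -- `hw` with the cut-off `φ`
  have hw' : ∀ u ∈ S, ∀ y : GnoFibreB L, ‖y‖ ≤ R →
      (∏ i, |gnoFibreBScale (L := L) u i|) * (((1 + (gnoFibreBEquiv (u, gnoScaleB u y)).1 ^ 2)⁻¹) ^ 2 * gnoDensity (gnoFibreBEquiv (u, gnoScaleB u y)).2) *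
          φ (Ψ' (u, y)) = gnomonicWeight (![0, u.1, u.2] : Fin 3 → ℝ) * Real.sqrt (1 + (u.1 ^ 2 + u.2 ^ 2)) * (1 + e (u, y)) := by
    intro u hu y hy
    rw [hφ, indicator_of_mem (hmemRg u hu y hy), ← hw u y]
  -- the off-tube bound
  have hoff : ∀ x, x ∉ Ψ' '' (S ×ˢ closedBall (0 : GnoFibreB L) R) → ‖Real.exp (-(b * (f x - 0))) * φ x‖ ≤ 1 * Real.exp (-(b * (lam * R ^ 2))) := by
    refine offTube_bound_of_cylinder (C := Rg) hb.le (fun x hx => by rw [hφ, indicator_of_notMem hx]) zero_le_one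
      (fun x hx => by rw [hφ, indicator_of_mem hx, abs_one]) fun x hx hxT => ?_
    have hcyl' : x ∈ Ψ' '' (S ×ˢ (univ : Set (GnoFibreB L))) := by
      rw [hΨ', gnoScaleBChart_image_prod_univ]; exact hcyl hx
    obtain ⟨u, hu, y, hRy, rfl⟩ := exists_of_mem_cylinderB_not_mem_scaledTube hcyl' hxT
    rw [zero_add, hfdef]
    exact hfar u hu y hRy.le hx
  -- apply the generic law
  obtain ⟨-, hbd⟩ := laplaceMethod_quantitative_fibred_chart_cubic_offBound_on (X := ℝ × GnoCoord L) (μ := μB) (M := ℝ × ℝ) (ν := volume) (V := GnoFibreB L)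
    (Ψ := Ψ') (J := fun q => (∏ i, |gnoFibreBScale (L := L) q.1 i|) *
      (((1 + (gnoFibreBEquiv (q.1, gnoScaleB q.1 q.2)).1 ^ 2)⁻¹) ^ 2 * gnoDensity (gnoFibreBEquiv (q.1, gnoScaleB q.1 q.2)).2)) (f := f) (φ := φ) (f₀ := 0)
    hS hp₀ (A := A) (fun u _ => hAs u) hlam0 hcoerS hAm (R := R) (A₃ := 1136016 * (L : ℝ) ^ 4) (D := 2 * R) (β := b) (Eoff := 1 * Real.exp (-(b * (lam * R ^ 2))))
    hR hA₃ (by positivity) hb hsmall hDR hΨm hTm hJm hJ0 hchart hfm hφm hρm hem hw0m (fun u _ => (hw0pos u).le) hw0i.integrableOn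
    hρS (fun u _ y hy => heb R hR.le u y hy) (fun u _ y _ => hf u y) hw' (by positivity) (Filter.Eventually.of_forall hoff)
  -- read back: the cut-off integral is the set integral over the window-cylinder
  rw [one_mul] at hbd
  have hlhs : ∫ x, Real.exp (-(b * (f x - 0))) * φ x ∂μB = ∫ p in Rg, Real.exp (-(b * f p)) ∂μB := by
    rw [← integral_indicator hRgm]
    refine integral_congr_ae (Filter.Eventually.of_forall fun x => ?_)
    show Real.exp (-(b * (f x - 0))) * φ x = Rg.indicator (fun p => Real.exp (-(b * f p))) x
    by_cases hx : x ∈ Rg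
    · rw [hφ, indicator_of_mem hx, indicator_of_mem hx, sub_zero, mul_one]
    · rw [hφ, indicator_of_notMem hx, indicator_of_notMem hx, mul_zero]
  rw [hlhs] at hbd
  exact hbd


/-! ## §2 The main-term package -/

/-- ★★★ **THE B-TUBE MAIN-TERM PACKAGE** (principal signs; `0 < τ ≤ 1`): ONE operator family `A′` on `V_B` with — symmetric; measurable form; the ray identity; `λ_B`-coercivity
on `{τ² ≤ |u|²}` (`λ_B = τ²∕((1+τ²)·12375·L¹⁰)`); the UNIFORM ceiling `⟪A′_u y,y⟫ ≤ 39984L⁴‖y‖²` (K7e); the determinant window `λ_B^{m_B} ≤ det A′_u ≤ (39984L⁴)^{m_B}` on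
`{τ² ≤ |u|²}`; `IntegrableOn (u ↦ w₀(u)∕√det A′_u) {τ² ≤ |u|²}`, `w₀(u) = w(0,u₁,u₂)√(1+|u|²)`; and the √b law of ✓`bTube_fibred_region_uniform` for THIS `A′`.
[cite: Luscher1983, §2] [cite: HasenpflugRudolfSprungk2024, App. 4.1 Thm 16] [cite: Breitung1994, Lemma 26 (2.102), p. 30] -/
theorem bTube_mainTerm_package (ε : GnoSign L) (hz : ε.2.1 = true) (hε : ε.2.2 = fun _ => true) {τ : ℝ} (hτ : 0 < τ) (hτ1 : τ ≤ 1) :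
    ∃ A' : ℝ × ℝ → GnoFibreB L →ₗ[ℝ] GnoFibreB L,
      (∀ u, (A' u).IsSymmetric) ∧
      (Measurable fun q : (ℝ × ℝ) × GnoFibreB L => ⟪A' q.1 q.2, q.2⟫_ℝ) ∧
      (∀ u (y : GnoFibreB L), ⟪A' u y, y⟫_ℝ =
        iteratedDeriv 2 (fun s : ℝ => gnoDeficit (fun _ => false) (fun _ => 1) (hubAt (gnoBaseB u + s • gnoFibreBEmb (gnoScaleB u y)).1 1) ε
          (gnoBaseB u + s • gnoFibreBEmb (gnoScaleB u y)).2) 0) ∧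
      (∀ u : ℝ × ℝ, τ ^ 2 ≤ u.1 ^ 2 + u.2 ^ 2 → ∀ y : GnoFibreB L, τ ^ 2 / ((1 + τ ^ 2) * (12375 * (L : ℝ) ^ 10)) * ‖y‖ ^ 2 ≤ ⟪A' u y, y⟫_ℝ) ∧
      (∀ u (y : GnoFibreB L), ⟪A' u y, y⟫_ℝ ≤ 39984 * (L : ℝ) ^ 4 * ‖y‖ ^ 2) ∧
      (∀ u : ℝ × ℝ, τ ^ 2 ≤ u.1 ^ 2 + u.2 ^ 2 →
        (τ ^ 2 / ((1 + τ ^ 2) * (12375 * (L : ℝ) ^ 10))) ^ finrank ℝ (GnoFibreB L) ≤ LinearMap.det (A' u) ∧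
          LinearMap.det (A' u) ≤ (39984 * (L : ℝ) ^ 4) ^ finrank ℝ (GnoFibreB L)) ∧
      IntegrableOn (fun u : ℝ × ℝ => gnomonicWeight (![0, u.1, u.2] : Fin 3 → ℝ) * Real.sqrt (1 + (u.1 ^ 2 + u.2 ^ 2)) / Real.sqrt (LinearMap.det (A' u)))
        {u : ℝ × ℝ | τ ^ 2 ≤ u.1 ^ 2 + u.2 ^ 2} ∧
      ∀ {S : Set (ℝ × ℝ)}, MeasurableSet S → S ⊆ {u : ℝ × ℝ | τ ^ 2 ≤ u.1 ^ 2 + u.2 ^ 2} → ∀ {p₀ : ℝ × ℝ}, p₀ ∈ S →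
      ∀ {Rg : Set (ℝ × GnoCoord L)}, MeasurableSet Rg → ∀ {R b : ℝ}, 0 < R → 0 < b →
        (∀ u ∈ S, ∀ y : GnoFibreB L, ‖y‖ ≤ R → gnoFibreBEquiv (u, gnoScaleB u y) ∈ Rg) → Rg ⊆ {p : ℝ × GnoCoord L | (p.2.1.1 1, p.2.1.1 2) ∈ S} →
        1136016 * (L : ℝ) ^ 4 * R ≤ τ ^ 2 / ((1 + τ ^ 2) * (12375 * (L : ℝ) ^ 10)) / (8 * ((finrank ℝ (GnoFibreB L) : ℝ) + 8)) → 2 * R * R ≤ 1 →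
        (∀ u ∈ S, ∀ y : GnoFibreB L, R ≤ ‖y‖ → gnoFibreBEquiv (u, gnoScaleB u y) ∈ Rg →
          τ ^ 2 / ((1 + τ ^ 2) * (12375 * (L : ℝ) ^ 10)) * R ^ 2 ≤
            gnoDeficit (fun _ => false) (fun _ => 1) (hubAt (gnoFibreBEquiv (u, gnoScaleB u y)).1 1) ε (gnoFibreBEquiv (u, gnoScaleB u y)).2) →
        |(∫ p in Rg,
              Real.exp (-(b * gnoDeficit (fun _ => false) (fun _ => 1) (hubAt p.1 1) ε p.2))
              ∂((volume : Measure (ℝ × GnoCoord L)).withDensity fun p => ENNReal.ofReal (((1 + p.1 ^ 2)⁻¹) ^ 2 * gnoDensity p.2))) -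
            (2 * Real.pi / b) ^ ((finrank ℝ (GnoFibreB L) : ℝ) / 2) *
              ∫ u in S, gnomonicWeight (![0, u.1, u.2] : Fin 3 → ℝ) * Real.sqrt (1 + (u.1 ^ 2 + u.2 ^ 2)) / Real.sqrt (LinearMap.det (A' u))| ≤
          ((16 * (1136016 * (L : ℝ) ^ 4) * ((finrank ℝ (GnoFibreB L) : ℝ) + 8) / (τ ^ 2 / ((1 + τ ^ 2) * (12375 * (L : ℝ) ^ 10))) +
                  256 * (1136016 * (L : ℝ) ^ 4) * ((finrank ℝ (GnoFibreB L) : ℝ) + 8) ^ 2 / (τ ^ 2 / ((1 + τ ^ 2) * (12375 * (L : ℝ) ^ 10))) ^ 2 + 2 * R +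
                  8 * (2 * R) * ((finrank ℝ (GnoFibreB L) : ℝ) + 8) / (τ ^ 2 / ((1 + τ ^ 2) * (12375 * (L : ℝ) ^ 10)))) / Real.sqrt b +
              16 * ((finrank ℝ (GnoFibreB L) : ℝ) + 8) / (τ ^ 2 / ((1 + τ ^ 2) * (12375 * (L : ℝ) ^ 10)) * R ^ 2) / b) *
            ((2 * Real.pi / b) ^ ((finrank ℝ (GnoFibreB L) : ℝ) / 2) *
              ∫ u in S, gnomonicWeight (![0, u.1, u.2] : Fin 3 → ℝ) * Real.sqrt (1 + (u.1 ^ 2 + u.2 ^ 2)) / Real.sqrt (LinearMap.det (A' u))) +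
          Real.exp (-(b * (τ ^ 2 / ((1 + τ ^ 2) * (12375 * (L : ℝ) ^ 10)) * R ^ 2))) *
            ((volume : Measure (ℝ × GnoCoord L)).withDensity fun p => ENNReal.ofReal (((1 + p.1 ^ 2)⁻¹) ^ 2 * gnoDensity p.2)).real univ := by
  classical
  obtain ⟨A, ρ, e, hAs, hAm, hρm, hem, hray, hcoer, hf, -, hw, heb⟩ := bFibre_rescaled_sockets (L := L) ε hz hε hτ hτ1
  have hL : (0 : ℝ) < (L : ℝ) := by exact_mod_cast NeZero.pos L
  set lam : ℝ := τ ^ 2 / ((1 + τ ^ 2) * (12375 * (L : ℝ) ^ 10)) with hlam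
  have hlam0 : 0 < lam := by positivity
  -- the uniform ceiling (K7e)
  have hup : ∀ u (y : GnoFibreB L), ⟪A u y, y⟫_ℝ ≤ 39984 * (L : ℝ) ^ 4 * ‖y‖ ^ 2 := by
    intro u y
    rw [hray]
    obtain ⟨b1, b2⟩ := transverse_gnoBaseB (L := L) u
    exact le_trans (le_abs_self _) (bFibre_rescaled_lineJets (fun _ => false) (fun _ => 1) ε u (gnoBaseB u) b1 b2 y 0).2.1
  have hdet : ∀ u : ℝ × ℝ, τ ^ 2 ≤ u.1 ^ 2 + u.2 ^ 2 →
      lam ^ finrank ℝ (GnoFibreB L) ≤ LinearMap.det (A u) ∧ LinearMap.det (A u) ≤ (39984 * (L : ℝ) ^ 4) ^ finrank ℝ (GnoFibreB L) := fun u hu =>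
    ⟨det_ge_pow_of_coercive (hAs u) hlam0 (hcoer u hu), det_le_pow_of_inner_le (hAs u) hlam0 (hcoer u hu) (hup u)⟩
  -- integrability of the main density on `{τ² ≤ |u|²}`: Fubini on the base-projected family
  set Sτ : Set (ℝ × ℝ) := {u : ℝ × ℝ | τ ^ 2 ≤ u.1 ^ 2 + u.2 ^ 2} with hSτ
  have hSτm : MeasurableSet Sτ := measurableSet_le measurable_const ((measurable_fst.pow_const 2).add (measurable_snd.pow_const 2))
  have hp₀ : ((τ, 0) : ℝ × ℝ) ∈ Sτ := by show τ ^ 2 ≤ τ ^ 2 + (0 : ℝ) ^ 2; simp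
  set prj : ℝ × ℝ → ℝ × ℝ := fun u => if u ∈ Sτ then u else (τ, 0) with hprj
  have hprjS : ∀ u, prj u ∈ Sτ := fun u => baseProj_mem hp₀ u
  have hprjm : Measurable prj := measurable_baseProj hSτm (τ, 0)
  have hprjid : ∀ u ∈ Sτ, prj u = u := fun u hu => by simp only [hprj, if_pos hu]
  obtain ⟨hw0pos, hw0m, hw0i⟩ := bBaseWeight_facts
  have hAm'' : Measurable fun q : (ℝ × ℝ) × GnoFibreB L => ⟪A (prj q.1) q.2, q.2⟫_ℝ := by
    have h := Measurable.comp hAm ((hprjm.comp measurable_fst).prodMk measurable_snd)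
    exact h
  haveI : SFinite ((volume : Measure (ℝ × ℝ)).restrict Sτ) := by infer_instance
  obtain ⟨-, hI, -⟩ := integral_gaussian_fibred (ν := (volume : Measure (ℝ × ℝ)).restrict Sτ) (A := fun u => A (prj u)) (fun u => hAs _) hlam0
    (fun u y => hcoer _ (hprjS u) y) hAm'' hw0m (fun u => (hw0pos u).le) hw0i.restrict one_pos
  have hint : IntegrableOn (fun u : ℝ × ℝ => gnomonicWeight (![0, u.1, u.2] : Fin 3 → ℝ) * Real.sqrt (1 + (u.1 ^ 2 + u.2 ^ 2)) /
      Real.sqrt (LinearMap.det (A u))) Sτ := by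
    have hc : (0 : ℝ) < (2 * Real.pi / 1) ^ ((finrank ℝ (GnoFibreB L) : ℝ) / 2) := Real.rpow_pos_of_pos (by positivity) _
    have h1 : IntegrableOn (fun u : ℝ × ℝ => gnomonicWeight (![0, u.1, u.2] : Fin 3 → ℝ) * Real.sqrt (1 + (u.1 ^ 2 + u.2 ^ 2)) *
        ((2 * Real.pi / 1) ^ ((finrank ℝ (GnoFibreB L) : ℝ) / 2) / Real.sqrt (LinearMap.det (A (prj u))))) Sτ := hI
    have h2 := h1.div_const ((2 * Real.pi / 1) ^ ((finrank ℝ (GnoFibreB L) : ℝ) / 2))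
    refine (integrableOn_congr_fun (fun u hu => ?_) hSτm).1 h2
    rw [hprjid u hu]
    field_simp
  refine ⟨A, hAs, hAm, hray, hcoer, hup, hdet, hint, ?_⟩
  exact bTube_law_of_socketData ε hz hε hτ hAs hAm hρm hem hray hcoer hf hw heb

end Summit.QuantumFields.YangMills.Theorems.SwapVirialDeficit.BlowUpRing

end
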